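import Summits.AtomisticToContinuum.HydrodynamicLimit.Theses.EulerCharacteristics

/-!
# `EulerCharacteristics.Assembly` — the rev-3 proof record (stmt-AtomisticToContinuum-14020, RETIRED)
# and the rev-6 frame from its open supports (stmt-AtomisticToContinuum-17580)

History. The assembly item of route `route-AtomisticToContinuum-EulerCharacteristics` at rev 3 was,
arrow for arrow, the type of the route file's then deciding theorem `closes`:

`GibbsInvariance → TransferInequality → HsEosLowDensity → ExpSecondLaw → ExponentialCellProblem →
TailBudget → FKTransferInProb → DiluteSelfConsistency → _root_.HydrodynamicLimit`,

and `eulerCharacteristics_assembly_proof : EulerCharacteristics.Assembly` proved it (item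
stmt-AtomisticToContinuum-14020, @ d8574088b2c8) by unfolding, eight `intro`s and `closes`. After the
statement re-type of `_root_.HydrodynamicLimit` (D-0032, p126922: the packing-guarded conjunct) the route
was repaired (rev 6, 2026-08-16T23:22Z: `Assembly` restated as the FRAME `ExponentialCellProblem →
TailBudget → _root_.HydrodynamicLimit` = stmt-AtomisticToContinuum-17580, `DiluteSelfConsistency` dropped;
rev 11, 23:56Z: crux-only deciding theorem `closes : ExponentialCellProblem → TailBudget →
NoDenseInclusions → ExpSecondLaw → FKTransferInProbR → _root_.HydrodynamicLimit`, `FKTransferInProb`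
dropped). The name `EulerCharacteristics.Assembly` thus changed meaning under this append-only file, whose
eight-`intro` proof stopped elaborating (full build 2026-08-17: `introN` failed at the third binder).

Status of the rev-6 frame. `Assembly` (stmt-17580) is NOT provable now: besides the two conjuncts of the
thesis it needs the three remaining antecedents of `closes` — the packing cap `NoDenseInclusions`
(stmt-14425), the exponential second law `ExpSecondLaw` (stmt-14608) and the re-typed Feng–Kurtz transfer
`FKTransferInProbR` (stmt-18039) — all OPEN cruxes of the route (the item's own note: it "closes by one
line … the moment ExpSecondLaw and FKTransferInProb close"). This file therefore records exactly that,
sorry-free: `eulerCharacteristics_assembly_of_supports : NoDenseInclusions → ExpSecondLaw →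
FKTransferInProbR → Assembly` (`fun hD hS hX hK hB => closes hK hB hD hS hX`), which does NOT close
stmt-17580 (its three hypotheses are open items), and keeps the landed name
`eulerCharacteristics_assembly_proof` as a DEPRECATED ALIAS of it (Theorems files are append-only; pattern
of `Theorems/CurvatureOrSymmetryAssemblyFrame.lean`). The rev-3 statement survives in the route file's
item records and in the ledger signature of stmt-14020. Nothing here discharges any crux.
-/

namespace Summit.AtomisticToContinuum.HydrodynamicLimit.Theorems

open Summit.AtomisticToContinuum.HydrodynamicLimit.Theses

/-- **The rev-6 frame of route `EulerCharacteristics` from its three open supports** (item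
stmt-AtomisticToContinuum-17580 is `Assembly := ExponentialCellProblem → TailBudget →
_root_.HydrodynamicLimit`): granted the packing cap `NoDenseInclusions` (stmt-14425: along the Euler
solution the local packing fraction stays below the threshold), the exponential second law
`ExpSecondLaw` (stmt-14608) and the re-typed Feng–Kurtz transfer in probability `FKTransferInProbR`
(stmt-18039) — the antecedents of the route's crux-only deciding theorem `closes` that are not conjuncts
of the thesis — the frame holds: `fun hK hB => closes hK hB hD hS hX`. The three hypotheses are OPEN
route items; this theorem does not close stmt-17580, it states what the frame still owes. [folklore] -/
theorem eulerCharacteristics_assembly_of_supports (hD : EulerCharacteristics.NoDenseInclusions)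
    (hS : EulerCharacteristics.ExpSecondLaw) (hX : EulerCharacteristics.FKTransferInProbR) :
    EulerCharacteristics.Assembly := by
  unfold EulerCharacteristics.Assembly
  intro hK hB
  exact EulerCharacteristics.closes hK hB hD hS hX

/-- Deprecated spelling: the rev-3 eight-arrow assembly `GibbsInvariance → TransferInequality →
HsEosLowDensity → ExpSecondLaw → ExponentialCellProblem → TailBudget → FKTransferInProb →
DiluteSelfConsistency → HydrodynamicLimit` (item stmt-AtomisticToContinuum-14020, proved @ d8574088b2c8,
replaced at route rev 6 by the frame stmt-AtomisticToContinuum-17580) was stated through the route decl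
`EulerCharacteristics.Assembly` BY NAME, whose definiens changed at rev 6; the old eight-`intro` proof no
longer elaborates and the new frame is not yet provable (three open supports), so the landed name is kept
as a deprecated alias of the conditional frame `eulerCharacteristics_assembly_of_supports` (Theorems files
are append-only). -/
@[deprecated eulerCharacteristics_assembly_of_supports (since := "2026-08-17")]
alias eulerCharacteristics_assembly_proof := eulerCharacteristics_assembly_of_supports

end Summit.AtomisticToContinuum.HydrodynamicLimit.Theorems
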